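import Literature.Computability.FineGrained.DiameterOVProgram
import Literature.Computability.FineGrained.CliqueETHGroupingReduction
import Literature.Computability.FineGrained.OVPolyDimProofs
import HarnessLib

/-!
# Orthogonal Vectors to Diameter 2 vs 3: the run, the word size, the time, and the OV algorithm

Completes the word-RAM reduction of `DiameterOVProgram.lean` (L. Roditty, V. Vassilevska Williams,
*Fast approximation algorithms for the diameter and radius of sparse graphs*, STOC 2013, §4 Thm. 9
in Orthogonal-Vectors form; cf. V. Vassilevska Williams, ICM 2018, §4, Diameter): from a
deterministic `O(m^{2-ε})`-time word-RAM program that `(3/2 - δ)`-approximates the diameter of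
connected sparse graphs (`(DiameterGapApprox (3/2 - δ)).InTimeO (m ↦ m^{2-ε})`, `0 < δ < 1/2`,
`0 < ε ≤ 1`) we obtain Orthogonal Vectors in deterministic word-RAM time
`O((n+1)^{2-ε} (d+1)^2)` (`OVInTimePolyDim ε` of `EditDistanceSETH.lean`, exponent `c = 2`):

* **the run** (`DiamRed.Params.reduction_outputsWithin`): the emulator's side conditions for the
  layout (`envOK`), the target invariant and the agreement of the emulated memory with the initial
  memory of the Diameter program on `y I` at the end of the build (`tinv_finMem`, `agree_finMem`),
  the read-out (`post_spec`: `[1]` iff the answer `D` is `3`, which by `DiamRed.eq_three_iff` happens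
  iff `I` has an orthogonal pair), whence by `SProg.outputsWithin_withSubrun` the OV program outputs
  the OV answer within `Tpre + 38 T + 5` steps;
* **the word size** (`kfit`, `Params.fits`): at `W = kfit · inputWidth x` everything fits;
* **the time** (`Params.Tpre_le` and the real-number bookkeeping): the build is linear in
  `(n+1)(d+1)`, the instance has `ne ≤ 2(n+1)(d+1)` entries, so the total is
  `O((n+1)^{2-ε} (d+1)^2)`;
* **`ovInTimePolyDim_of_diameterGapApprox_inTimeO`**, its hypothesis-form consequences
  `not_diameterGapApprox_inTimeO_of_ovhWordRAM` (OVH ⇒ S16) and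
  `not_diameterGapApprox_inTimeO_of_sethWordRAM_of` (from the named fact
  `kSATInRAMTime_of_ovInTimePolyDim`), and the **discharge
  `not_diameterGapApprox_inTimeO_of_sethWordRAM_holds`** of fine-grained.S16, using the proved
  split-and-list reduction `kSATInRAMTime_of_ovInTimePolyDim_holds` of `OVPolyDimProofs.lean`.

## References

* L. Roditty, V. Vassilevska Williams, *Fast approximation algorithms for the diameter and radius
  of sparse graphs*, STOC 2013, §1 Thm. 4, §4 Thm. 9 and the Remark following it.
* V. Vassilevska Williams, *On some fine-grained questions in algorithms and complexity*,
  Proc. ICM 2018, §2 (word RAM), §4 (Diameter).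
-/

namespace Literature.Computability.FineGrained

open Cryptography Cryptography.WordRAM Cryptography.WordRAM.SProg CliqueRed

namespace DiamRed

namespace Params

variable (g : Params) {W : ℕ} {O : List ℕ → List ℕ}

/-! ### The run -/

/-- The emulator's side conditions hold for the layout `CliqueRed.lay` and the environment `g.env`.
[folklore] -/
theorem envOK (hF : g.Fits W) : EnvOK lay g.env W := by
  obtain ⟨hX, hBv, hSv, htop, hV, hLy, hPw1, hPwW, hLx2, -⟩ := g.facts hF
  refine ⟨by decide, by decide, by decide, by decide, by decide, by decide, by decide,
    fun r hr => ?_, Or.inl ?_, ?_, ?_, hF.ws_lt.le⟩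
  · simp only [lay, Layout.regs, List.mem_cons, List.not_mem_nil, or_false] at hr
    show r < g.Bv ∧ r < g.Sv
    rcases hr with rfl | rfl | rfl | rfl | rfl | rfl | rfl <;> omega
  · show g.Bv + (g.V + 1) ≤ g.Sv; omega
  · show g.Bv + (g.V + 1) ≤ 2 ^ W; omega
  · show g.Sv + (g.V + 1) ≤ 2 ^ W; omega

/-- Every emitted word is below `Pw`. [folklore] -/
theorem emitted_lt (i : ℕ) : g.emitted.getD i 0 < g.Pw := by
  rw [List.getD_eq_getElem?_getD]
  cases h : g.emitted[i]? with
  | none => simp only [Option.getD_none]; exact Nat.two_pow_pos g.ws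
  | some v =>
    obtain ⟨u, -, rfl⟩ := List.mem_map.1 (List.mem_of_getElem? h)
    exact Nat.mod_lt _ Nat.one_le_two_pow

/-- Every cell of the final memory is below `2 ^ W`. [folklore] -/
theorem finMem_lt (hF : g.Fits W) (a : ℕ) : g.finMem a < 2 ^ W := by
  obtain ⟨hX, hBv, hSv, htop, hV, hLy, hPw1, hPwW, hLx2, -⟩ := g.facts hF
  unfold finMem
  by_cases ha : a < 100
  · rw [if_pos ha]; split_ifs <;> omega
  rw [if_neg ha]
  unfold writeFrom
  split_ifs
  · exact (g.emitted_lt _).trans hPwW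
  · exact lt_of_le_of_lt (relocated_le_of_forall (B := 2 ^ W - 1)
      (fun v hv => Nat.le_sub_one_of_lt (hF.input v hv)) (by omega)) (by omega)

/-- The stamps are untouched: `0` from `Sv` on. [folklore] -/
theorem finMem_Sv_add (hF : g.Fits W) (a : ℕ) : g.finMem (g.Sv + a) = 0 := by
  obtain ⟨hX, hBv, hSv, htop, hV, hLy, hPw1, hPwW, hLx2, -⟩ := g.facts hF
  unfold finMem
  rw [if_neg (by omega), writeFrom_of_le _ _ (by rw [length_emitted]; omega)]
  exact g.relocated_of_Bv_le (by omega)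

/-- **The target invariant at the end of the build.** [folklore] -/
theorem tinv_finMem (hF : g.Fits W) : TInv lay g.env (2 ^ W - 1) g.finMem := by
  refine ⟨⟨?_, ?_, ?_, ?_⟩, fun a _ => ?_, fun a => Nat.le_sub_one_of_lt (g.finMem_lt hF a)⟩
  · show g.finMem 10 = g.Bv; simp [finMem]
  · show g.finMem 11 = g.Sv; simp [finMem]
  · show g.finMem 12 = 0; simp [finMem]
  · show g.finMem 13 = 2 ^ g.ws; simp [finMem]; rfl
  · show g.finMem (g.Sv + a) ≤ 0
    rw [g.finMem_Sv_add hF a]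

/-- **The emulated input is in place at the end of the build**: below the region size, the emulated
memory is the initial memory of the Diameter program on `y I` at word size `ws`. [folklore] -/
theorem agree_finMem (hF : g.Fits W) : Agree g.env g.finMem (init g.ws g.yv).mem := by
  obtain ⟨hX, hBv, hSv, htop, hV, hLy, hPw1, hPwW, hLx2, -⟩ := g.facts hF
  have hlen : g.yv.length = g.Ly := g.length_yv
  intro a _
  have hstamp : g.finMem (g.Sv + a) = 0 := g.finMem_Sv_add hF a
  show (if g.finMem (g.Sv + a) = 0 then g.finMem (g.Bv + a) else 0) = (init g.ws g.yv).mem a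
  rw [if_pos hstamp]
  unfold finMem
  rw [if_neg (by omega)]
  rcases Nat.lt_or_ge a (g.Ly + 1) with ha | ha
  · rw [writeFrom_base_add _ _ (by rw [length_emitted]; exact ha), emitted,
      show (0 : ℕ) = 0 % g.Pw from (Nat.zero_mod _).symm, List.getD_map]
    rcases Nat.eq_zero_or_pos a with rfl | hpos
    · rw [init_mem_zero, hlen]; rfl
    · obtain ⟨i, rfl⟩ := Nat.exists_eq_add_of_le' hpos
      rw [List.getD_cons_succ, init_mem_succ _ _ _ (by omega), List.getD_eq_getElem _ _ (by omega)]
      rfl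
  · rw [writeFrom_of_le _ _ (by rw [length_emitted]; omega), init_mem_of_length_lt _ _ _ (by omega)]
    exact g.relocated_of_Bv_le (by omega)

/-- **The read-out.** From any memory agreeing with the halting memory `dm` of the Diameter program
(target invariant kept), `post` outputs `[1]` if `dm 1 = 3` and `[0]` otherwise, in `4` steps.
[folklore] -/
theorem post_spec (hF : g.Fits W) {m₂ dm : ℕ → ℕ} (hag : Agree g.env m₂ dm)
    (hI : TInv lay g.env (2 ^ W - 1) m₂) (qs : List (List ℕ)) :
    ∃ (st₃ : Store) (t₃ : ℕ), t₃ ≤ 4 ∧ Exec W O post ⟨m₂, qs⟩ st₃ t₃ ∧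
      readOut st₃.mem = [if dm 1 = 3 then 1 else 0] := by
  obtain ⟨hX, hBv, hSv, htop, hV, hLy, hPw1, hPwW, hLx2, -⟩ := g.facts hF
  have h10 : m₂ 10 = g.Bv := hI.env.1
  have hst : m₂ (g.Sv + 1) = 0 := Nat.le_zero.1 (hI.stamp 1 (by show 1 < g.V + 1; omega))
  have h1 : m₂ (g.Bv + 1) = dm 1 := by
    have := hag 1 (by show 1 < g.V + 1; omega)
    simp only [edec, Params.env, hst, if_true] at this
    exact this
  refine ⟨_, 4, le_rfl, Exec.block _ m₂ qs, ?_⟩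
  have hm : execOps W m₂ [(.add, r 17, r 10, im 1), (.band, r 1, pt 17, pt 17), (.eq, r 1, r 1, im 3),
      (.band, r 0, im 1, im 1)] =
      Function.update (Function.update (Function.update (Function.update m₂ 17 (g.Bv + 1)) 1 (dm 1)) 1
        (if dm 1 = 3 then 1 else 0)) 0 1 := by
    simp (disch := first | omega | decide) only [execOps_cons, execOps_nil, execOp, Operand.write,
      Operand.read, Function.update_self, Function.update_of_ne, h10, BinOp.eval_add_of_lt,
      BinOp.eval_band, BinOp.eval_eq, Nat.and_self]
    rw [h1]
  show readOut (execOps W m₂ _) = _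
  rw [hm]
  simp [readOut, readSeg, Function.update_self, Function.update_of_ne]

/-- The total time of the OV program, given a time bound `T` for the Diameter program. [folklore] -/
noncomputable def Ttotal (T : ℕ) : ℕ := g.Tpre + cstep * T + 5

/-- **The OV program's output.** At a word size `W` with `g.Fits W`, if the deterministic
oracle-free Diameter program `M` (largest constant `cM`) outputs `[D]` on `y I` at word size
`ws = kM · size Ly` within `T` steps, then the OV program outputs `[1]` if `D = 3` and `[0]`
otherwise, on `x = OV.encode I`, within `Tpre + 38 T + 5` steps. [folklore] -/
theorem reduction_outputsWithin (hF : g.Fits W) {M : Program} (hdet : M.IsDeterministic)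
    (hof : M.IsOracleFree) (hcM : M.maxConst = g.cM) {T D : ℕ}
    (hM : OutputsWithin M g.ws noOracle zeroCoins g.yv [D] T) :
    OutputsWithin (withSubrun (pre g.kM g.cM) lay M post) W noOracle zeroCoins g.x
      [if D = 3 then 1 else 0] (g.Ttotal T) := by
  obtain ⟨hX, hBv, hSv, htop, hV, hLy, hPw1, hPwW, hLx2, -⟩ := g.facts hF
  have hW1 : 1 ≤ W := by have := hF.ws_lt; omega
  have h2W : 2 ≤ 2 ^ W := by
    calc (2 : ℕ) = 2 ^ 1 := rfl
      _ ≤ 2 ^ W := Nat.pow_le_pow_right (by norm_num) hW1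
  obtain ⟨st₁, t₁, ht₁, hexec, hmem, hqs⟩ := (g.pre_spec (O := noOracle) hF).exists_exec
  obtain ⟨dh, hhalt, hout⟩ := (outputsWithin_iff_exists_haltsWithin _ _ _ _ _ _ _).1 hM
  have hst₁ : st₁ = ⟨g.finMem, []⟩ := by cases st₁; simp only at hmem hqs; rw [hmem, hqs]
  subst hst₁
  have key := outputsWithin_withSubrun (O := noOracle) zeroCoins (pre := pre g.kM g.cM)
    (post := post) (L := lay) (E := g.env) (VT := 2 ^ W - 1) (V := g.V) (M := M) (x := g.x)
    (y := g.yv) (out := [if D = 3 then 1 else 0]) (T₂ := 4) hF.width hexec (g.envOK hF) (by omega)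
    (by omega)
    (fun r hr => by
      simp only [lay, Layout.regs, List.mem_cons, List.not_mem_nil, or_false] at hr
      rcases hr with rfl | rfl | rfl | rfl | rfl | rfl | rfl <;> omega)
    hdet hof (by rw [hcM]; omega) (by show g.V < g.V + 1; omega) (by omega)
    (by show 2 ^ g.ws - 1 ≤ g.V; unfold Pw at hV; omega) (by omega)
    (g.tinv_finMem hF) (g.agree_finMem hF) hhalt
    (fun m₂ hag hI _ => by
      have := g.post_spec (O := noOracle) hF hag hI []
      rwa [mem_one_of_readOut hout] at this)
  exact key.mono (by unfold Ttotal; omega)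

/-! ### The word size -/

/-- **The word-size constant** of the OV program: with `W = kfit · inputWidth x` every address and
value of the run fits (`fits`). [folklore] -/
def _root_.Literature.Computability.FineGrained.DiamRed.kfit (kM cM : ℕ) : ℕ :=
  5 * kM + Nat.size (2 * cM + 137) + 7

/-- `(n+1)(d+1) < 4 · 2^w` for the input width `w`: `n, d` and `2 + 2nd` are below `2^w`. [folklore] -/
theorem succ_mul_succ_lt : (g.I.n + 1) * (g.I.d + 1) < 4 * 2 ^ inputWidth g.x := by
  have hLx : g.Lx < 2 ^ inputWidth g.x := length_lt_two_pow_inputWidth _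
  rw [g.Lx_eq] at hLx
  have hn : g.I.n < 2 ^ inputWidth g.x :=
    lt_two_pow_inputWidth_of_mem _ _ (by unfold x; rw [OV_encode_eq]; simp)
  have hd : g.I.d < 2 ^ inputWidth g.x :=
    lt_two_pow_inputWidth_of_mem _ _ (by unfold x; rw [OV_encode_eq]; simp)
  nlinarith

/-- `Ly < 2^(w + 4)`. [folklore] -/
theorem Ly_lt : g.Ly < 2 ^ (inputWidth g.x + 4) := by
  have h := g.succ_mul_succ_lt
  have hLy : g.Ly = 4 * ((g.I.n + 1) * (g.I.d + 1)) := by unfold Ly nE ne; ring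
  rw [hLy, Nat.pow_add]
  norm_num
  omega

/-- `ws ≤ 5 kM w`. [folklore] -/
theorem ws_le : g.ws ≤ 5 * g.kM * inputWidth g.x := by
  have hw1 : 1 ≤ inputWidth g.x := inputWidth_pos _
  have hsz : Nat.size g.Ly ≤ inputWidth g.x + 4 := Nat.size_le.2 g.Ly_lt
  unfold ws
  calc g.kM * Nat.size g.Ly ≤ g.kM * (inputWidth g.x + 4) := Nat.mul_le_mul_left _ hsz
    _ ≤ g.kM * (5 * inputWidth g.x) := Nat.mul_le_mul_left _ (by omega)
    _ = 5 * g.kM * inputWidth g.x := by ring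

/-- **The word size fits.** The run at word size `kfit · inputWidth x` satisfies `Fits`. [folklore] -/
theorem fits : g.Fits (kfit g.kM g.cM * inputWidth g.x) := by
  set w := inputWidth g.x with hw
  have hw1 : 1 ≤ w := inputWidth_pos _
  have hLx : g.Lx < 2 ^ w := length_lt_two_pow_inputWidth _
  have hLy : g.Ly < 2 ^ (w + 4) := g.Ly_lt
  have hws : g.ws ≤ 5 * g.kM * w := g.ws_le
  set E := 5 * g.kM * w + (w + 4) with hE
  have h2E : ∀ t, t ≤ E → 2 ^ t ≤ 2 ^ E := fun t ht => Nat.pow_le_pow_right Nat.two_pos ht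
  have hPw : g.Pw ≤ 2 ^ E := h2E _ (by omega)
  have hLxE : g.Lx ≤ 2 ^ E := hLx.le.trans (h2E _ (by omega))
  have hLyE : g.Ly ≤ 2 ^ E := hLy.le.trans (h2E _ (by omega))
  set A := 2 * g.cM + 137 with hA
  -- the top of the stamp region
  have htop : g.Sv + g.V + 1 ≤ A * 2 ^ E := by
    have e : g.Sv + g.V + 1 = 2 * g.Lx + 2 * g.Pw + 2 * g.cM + 2 * g.Ly + 101 := by
      unfold Sv Bv X V; have := (Nat.one_le_two_pow : 1 ≤ g.Pw); unfold Pw at this ⊢; omega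
    rw [e]
    have e1 : 2 * g.Lx ≤ 2 * 2 ^ E := by omega
    have e2 : 2 * g.Pw ≤ 2 * 2 ^ E := by omega
    have e3 : 2 * g.cM ≤ 2 * g.cM * 2 ^ E := le_self_mul_two_pow _ _
    have e4 : 2 * g.Ly ≤ 2 * 2 ^ E := by omega
    have e5 : 101 ≤ 131 * 2 ^ E := le_trans (by norm_num) (le_self_mul_two_pow 131 E)
    have hsum := add_le_mul_two_pow (add_le_mul_two_pow (add_le_mul_two_pow (add_le_mul_two_pow e1 e2) e3) e4) e5
    rw [show 2 + 2 + 2 * g.cM + 2 + 131 = A by rw [hA]; ring] at hsum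
    exact hsum
  have htot : g.Sv + g.V + 1 ≤ 2 ^ (Nat.size A + E) := htop.trans (mul_two_pow_le_two_pow_size_add A E)
  -- the word size
  set sA := Nat.size A with hsA
  have hkfit : kfit g.kM g.cM = 5 * g.kM + sA + 7 := rfl
  have hW : sA + E + 1 ≤ kfit g.kM g.cM * w := by
    rw [hkfit, hE, Nat.add_mul, Nat.add_mul]
    have h1 : sA ≤ sA * w := Nat.le_mul_of_pos_right _ hw1
    have h2 : 7 * w = w + 6 * w := by ring
    omega
  have hk1 : w ≤ kfit g.kM g.cM * w :=
    calc w = 1 * w := (one_mul _).symm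
      _ ≤ kfit g.kM g.cM * w := Nat.mul_le_mul_right _ (by rw [hkfit]; omega)
  exact ⟨htot.trans (Nat.pow_le_pow_right Nat.two_pos (by omega)), by omega, hk1⟩

/-! ### The time -/

/-- **The running time of the build**, linear in `(n+1)(d+1)`. [folklore] -/
theorem Tpre_le : g.Tpre ≤ 200 * ((g.I.n + 1) * (g.I.d + 1)) := by
  have hLx := g.Lx_eq
  have hLy : g.Ly = 4 * ((g.I.n + 1) * (g.I.d + 1)) := by unfold Ly nE ne; ring
  have hsz : Nat.size g.Ly ≤ g.Ly := size_le_self _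
  have hprod : (g.I.n + 1) * (g.I.d + 1) = g.I.n * g.I.d + g.I.n + g.I.d + 1 := by ring
  have h1 : g.I.n * (10 + ((g.I.d * (15 + 2) + 1) + 2) + 2) = 17 * (g.I.n * g.I.d) + 15 * g.I.n := by ring
  have h2 : g.I.n * (11 + ((g.I.d * (15 + 2) + 1) + 2) + 2) = 17 * (g.I.n * g.I.d) + 16 * g.I.n := by ring
  unfold Tpre
  omega

/-- `ne ≤ 2 (n+1)(d+1)`. [folklore] -/
theorem ne_le (I : OVInstance) : ne I ≤ 2 * ((I.n + 1) * (I.d + 1)) := by unfold ne; nlinarith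

/-- The real-number bookkeeping: `Tpre + 38 ⌊C ne^{2-ε} + C⌋₊ + 5 ≤ (205 + 190 max C 0) (n+1)^{2-ε} (d+1)^2`
for `0 < ε ≤ 1`. [folklore] -/
theorem Ttotal_le {ε : ℝ} (hε : 0 < ε) (hε1 : ε ≤ 1) (C : ℝ) :
    ((g.Ttotal ⌊C * ((ne g.I : ℕ) : ℝ) ^ (2 - ε) + C⌋₊ : ℕ) : ℝ) ≤
      (205 + 190 * max C 0) * ((((g.I.n : ℝ) + 1) ^ (2 - ε)) * ((g.I.d : ℝ) + 1) ^ (2 : ℕ)) := by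
  set C₀ := max C 0 with hC₀
  have hC₀0 : 0 ≤ C₀ := le_max_right _ _
  have hCC₀ : C ≤ C₀ := le_max_left _ _
  set a : ℝ := (g.I.n : ℝ) + 1 with ha
  set b : ℝ := (g.I.d : ℝ) + 1 with hb
  have ha1 : 1 ≤ a := by rw [ha]; have := (Nat.cast_nonneg g.I.n : (0:ℝ) ≤ g.I.n); linarith
  have hb1 : 1 ≤ b := by rw [hb]; have := (Nat.cast_nonneg g.I.d : (0:ℝ) ≤ g.I.d); linarith
  have ha0 : 0 ≤ a := by linarith
  have hb0 : 0 ≤ b := by linarith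
  set P : ℝ := a ^ (2 - ε) * b ^ (2 : ℕ) with hP
  -- `a b ≤ P` and `1 ≤ P`
  have haP : a ≤ a ^ (2 - ε) := by
    calc a = a ^ (1 : ℝ) := (Real.rpow_one a).symm
      _ ≤ a ^ (2 - ε) := Real.rpow_le_rpow_of_exponent_le ha1 (by linarith)
  have hbP : b ≤ b ^ (2 : ℕ) := by nlinarith
  have hab : a * b ≤ P := mul_le_mul haP hbP hb0 (le_trans ha0 haP)
  have h1P : 1 ≤ P := le_trans (by nlinarith) hab
  have hP0 : 0 ≤ P := by linarith
  -- the Diameter program's time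
  have hne : ((ne g.I : ℕ) : ℝ) ≤ 2 * (a * b) := by
    have := ne_le g.I; rw [ha, hb]; exact_mod_cast this
  have hne0 : (0 : ℝ) ≤ ((ne g.I : ℕ) : ℝ) := Nat.cast_nonneg _
  have hpow : ((ne g.I : ℕ) : ℝ) ^ (2 - ε) ≤ 4 * P := by
    calc ((ne g.I : ℕ) : ℝ) ^ (2 - ε) ≤ (2 * (a * b)) ^ (2 - ε) := Real.rpow_le_rpow hne0 hne (by linarith)
      _ = (2 : ℝ) ^ (2 - ε) * (a ^ (2 - ε) * b ^ (2 - ε)) := by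
          rw [Real.mul_rpow (by norm_num) (by positivity), Real.mul_rpow ha0 hb0]
      _ ≤ 4 * (a ^ (2 - ε) * b ^ (2 : ℕ)) := by
          have h2 : (2 : ℝ) ^ (2 - ε) ≤ 4 := by
            calc (2 : ℝ) ^ (2 - ε) ≤ (2 : ℝ) ^ (2 : ℝ) := Real.rpow_le_rpow_of_exponent_le (by norm_num) (by linarith)
              _ = 4 := by norm_num
          have hb2 : b ^ (2 - ε) ≤ b ^ (2 : ℕ) := by
            calc b ^ (2 - ε) ≤ b ^ ((2 : ℕ) : ℝ) := Real.rpow_le_rpow_of_exponent_le hb1 (by norm_num; linarith)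
              _ = b ^ (2 : ℕ) := Real.rpow_natCast b 2
          have ha2 : 0 ≤ a ^ (2 - ε) := Real.rpow_nonneg ha0 _
          have hbb : 0 ≤ b ^ (2 - ε) := Real.rpow_nonneg hb0 _
          calc (2 : ℝ) ^ (2 - ε) * (a ^ (2 - ε) * b ^ (2 - ε)) ≤ 4 * (a ^ (2 - ε) * b ^ (2 - ε)) :=
                mul_le_mul_of_nonneg_right h2 (mul_nonneg ha2 hbb)
            _ ≤ 4 * (a ^ (2 - ε) * b ^ (2 : ℕ)) := by
                apply mul_le_mul_of_nonneg_left _ (by norm_num)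
                exact mul_le_mul_of_nonneg_left hb2 ha2
  have hTM : ((⌊C * ((ne g.I : ℕ) : ℝ) ^ (2 - ε) + C⌋₊ : ℕ) : ℝ) ≤ C₀ * (4 * P) + C₀ := by
    have hr0 : (0 : ℝ) ≤ ((ne g.I : ℕ) : ℝ) ^ (2 - ε) := Real.rpow_nonneg hne0 _
    rcases le_or_gt 0 (C * ((ne g.I : ℕ) : ℝ) ^ (2 - ε) + C) with h0 | h0
    · calc ((⌊C * ((ne g.I : ℕ) : ℝ) ^ (2 - ε) + C⌋₊ : ℕ) : ℝ) ≤ C * ((ne g.I : ℕ) : ℝ) ^ (2 - ε) + C :=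
            Nat.floor_le h0
        _ ≤ C₀ * ((ne g.I : ℕ) : ℝ) ^ (2 - ε) + C₀ := add_le_add (mul_le_mul_of_nonneg_right hCC₀ hr0) hCC₀
        _ ≤ C₀ * (4 * P) + C₀ := by nlinarith [mul_le_mul_of_nonneg_left hpow hC₀0]
    · rw [Nat.floor_of_nonpos h0.le]; simp; nlinarith
  -- the build
  have hpre : (g.Tpre : ℝ) ≤ 200 * (a * b) := by
    have := g.Tpre_le; rw [ha, hb]; exact_mod_cast this
  unfold Ttotal cstep
  push_cast
  nlinarith [hab, h1P, hTM, hpre, mul_nonneg hC₀0 hP0]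

end Params

/-! ### The OV algorithm -/

open scoped Classical in
/-- The accepted output of `OV` on `I` is `[1]` or `[0]` according to `HasOrthogonalPair`. [folklore] -/
theorem OV_good_eq (I : OVInstance) : OV.Good I = {[if I.HasOrthogonalPair then 1 else 0]} := by
  by_cases h : I.HasOrthogonalPair
  · rw [if_pos h]; exact FGProblem.ofPred_good_of_pos _ _ _ _ h
  · rw [if_neg h]; exact FGProblem.ofPred_good_of_neg _ _ _ _ h

/-- **Subquadratic `(3/2 - δ)`-approximation of the diameter of sparse graphs solves OV in
`n^{2-ε} poly(d)` time** (Roditty–Vassilevska Williams, STOC 2013, §4 Thm. 9 with the Remark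
following it, in Orthogonal-Vectors form; cf. VVW ICM 2018, §4): if for some `0 < ε ≤ 1` and
`0 < δ < 1/2` the problem `DiameterGapApprox (3/2 - δ)` (connected sparse graphs by edge lists, size
`m` = number of entries) has a deterministic `O(m^{2-ε})`-time word-RAM algorithm, then Orthogonal
Vectors is decided on the deterministic word RAM within `⌊C ((n+1)^{2-ε} (d+1)^2)⌋₊` steps
(`OVInTimePolyDim ε`). Proof: the program `DiamRed.ovProgram` builds the edge list of the graph of
`DiameterOVGraph.lean` (`1 + 2d + 2n(1+d) ≤ 2(n+1)(d+1)` entries; diameter `3` iff an orthogonal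
pair exists, else `≤ 2`), runs the Diameter program on it as an emulated sub-run at its own word
size, and answers `1` iff the returned approximation is `3`.
[cite: RodittyVassilevskaWilliamsSTOC2013, §4 Thm. 9 and Remark] -/
theorem ovInTimePolyDim_of_diameterGapApprox_inTimeO {ε : ℝ} (hε : 0 < ε) (hε1 : ε ≤ 1) {δ : ℚ}
    (hδ : 0 < δ) (hδ' : δ < 1 / 2)
    (h : (DiameterGapApprox (3 / 2 - δ)).InTimeO fun m => (m : ℝ) ^ (2 - ε)) :
    OVInTimePolyDim ε := by
  obtain ⟨C, M, k, hdet, hof, hM⟩ := h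
  refine ⟨205 + 190 * max C 0, 2, ovProgram M k, kfit k M.maxConst, ovProgram_isDeterministic _ _,
    ovProgram_isOracleFree _ _, fun (I : OVInstance) => ?_⟩
  set g : Params := ⟨I, k, M.maxConst⟩ with hg
  have hα : (0 : ℚ) < 3 / 2 - δ := by linarith
  have hα' : (3 / 2 - δ : ℚ) < 3 / 2 := by linarith
  -- the Diameter program on the instance
  obtain ⟨out, hout, hrun⟩ := hM (dInst I (3 / 2 - δ))
  obtain ⟨D, rfl, hD⟩ := exists_of_mem_good I hα hα' hout
  have hws : k * (DiameterGapApprox (3 / 2 - δ)).width (dInst I (3 / 2 - δ)) = g.ws := by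
    show k * inputWidth (encodeEdgeList (edges I)) = k * Nat.size g.Ly
    rw [← y, inputWidth_y]; rfl
  simp only [hws, encode_dInst, size_dInst] at hrun
  have key := g.reduction_outputsWithin g.fits hdet hof rfl hrun
  refine ⟨[if D = 3 then 1 else 0], ?_, key.mono (Nat.le_floor (g.Ttotal_le hε hε1 C))⟩
  rw [OV_good_eq, Set.mem_singleton_iff]
  by_cases hp : I.HasOrthogonalPair
  · rw [if_pos (hD.2 hp), if_pos hp]
  · rw [if_neg (fun h3 => hp (hD.1 h3)), if_neg hp]

end DiamRed

/-! ### fine-grained.S16 from OVH, and from SETH given Williams' split-and-list reduction -/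

/-- **OVH ⇒ fine-grained.S16** (Roditty–Vassilevska Williams, STOC 2013, Thm. 4 / §4 Thm. 9 with
SETH replaced by the Orthogonal-Vectors hypothesis OVH of Bringmann–Künnemann, FOCS 2015, §2.1, as
in VVW ICM 2018, §4): if for no `ε > 0` Orthogonal Vectors is in deterministic word-RAM time
`O((n+1)^{2-ε} (d+1)^c)` (`OVHWordRAM`), then for all `ε > 0` and `0 < δ < 1/2` there is no
deterministic `O(m^{2-ε})`-time `(3/2 - δ)`-approximation of the diameter of connected sparse
graphs (`DiameterGapApprox (3/2 - δ)`). (Shrink `ε` to `min ε 1` first: an `O(m^{2-ε})` algorithm is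
an `O(m^{2 - min ε 1})` one.) [cite: RodittyVassilevskaWilliamsSTOC2013, §4 Thm. 9] -/
theorem not_diameterGapApprox_inTimeO_of_ovhWordRAM (h : OVHWordRAM) (ε : ℝ) (hε : 0 < ε) (δ : ℚ)
    (hδ : 0 < δ) (hδ' : δ < 1 / 2) :
    ¬ (DiameterGapApprox (3 / 2 - δ)).InTimeO fun m => (m : ℝ) ^ (2 - ε) := by
  intro hA
  have hA₁ := inTimeO_rpow_two_sub_anti (min_le_left ε 1) hA
  exact h (min ε 1) (lt_min hε one_pos)
    (DiamRed.ovInTimePolyDim_of_diameterGapApprox_inTimeO (lt_min hε one_pos) (min_le_right ε 1) hδ hδ' hA₁)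

/-- **Assembly of fine-grained.S16 in the word-RAM model.** Williams' split-and-list reduction on
the word RAM (`kSATInRAMTime_of_ovInTimePolyDim`, the named fact of `EditDistanceSETH.lean`:
word-RAM SETH ⇒ OVH, `ovhWordRAM_of_sethWordRAM_of`) and the OV-to-Diameter reduction proved here
give the printed theorem `not_diameterGapApprox_inTimeO_of_sethWordRAM` (Roditty–Vassilevska
Williams, STOC 2013, Thm. 4 = Thm. 1.3 of the statement file's numbering; §4 Thm. 9) verbatim.
[cite: RodittyVassilevskaWilliamsSTOC2013, Thm. 4 and §4 Thm. 9] -/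
theorem not_diameterGapApprox_inTimeO_of_sethWordRAM_of (hY : kSATInRAMTime_of_ovInTimePolyDim) :
    not_diameterGapApprox_inTimeO_of_sethWordRAM :=
  fun hSETH ε hε δ hδ hδ' =>
    not_diameterGapApprox_inTimeO_of_ovhWordRAM (ovhWordRAM_of_sethWordRAM_of hY hSETH) ε hε δ hδ hδ'

/-- **fine-grained.S16, discharged** (L. Roditty, V. Vassilevska Williams, *Fast approximation
algorithms for the diameter and radius of sparse graphs*, STOC 2013, Thm. 4 of the authors' version
— Thm. 1.3 in the numbering cited by `SETHHardness.lean` —, proved in §4 as Thm. 9 with the Remark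
following it: "Suppose one can distinguish between diameter 2 and 3 in an `m`-edge undirected
unweighted graph in time `O(m^{2-ε})` for some constant `ε > 0`. Then … CNF-SAT on `n` variables
and `m` clauses is in `O(2^{n(1-ε/2)} poly(m, n))` time, and SETH is false" / "any
`(3/2 - ε)`-approximation algorithm can distinguish between diameter 2 and 3"). Assuming word-RAM
SETH, for all `ε > 0` and `0 < δ < 1/2` there is no deterministic `O(m^{2-ε})`-time word-RAM
algorithm `(3/2 - δ)`-approximating the diameter of connected sparse graphs. Proof: word-RAM SETH
⇒ OVH by Williams' split-and-list reduction in polynomial dimension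
(`kSATInRAMTime_of_ovInTimePolyDim_holds`, `OVPolyDimProofs.lean`), and OVH ⇒ S16 by the
OV-to-Diameter reduction of this file (`ovInTimePolyDim_of_diameterGapApprox_inTimeO`); both in the
one machine model of the sources, the word RAM. [cite: RodittyVassilevskaWilliamsSTOC2013, Thm. 4 and §4 Thm. 9 (authors' version)] -/
theorem not_diameterGapApprox_inTimeO_of_sethWordRAM_holds : not_diameterGapApprox_inTimeO_of_sethWordRAM :=
  not_diameterGapApprox_inTimeO_of_sethWordRAM_of kSATInRAMTime_of_ovInTimePolyDim_holds

end Literature.Computability.FineGrained
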